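import Summits.Ventures.CertifiedManyBodySolver.Downfold.EmeryFermiSurfaceShapeBox
import HarnessLib

/-!
# The Fermi-surface `t′/t` of the σ three-band model on a parameter box × Fermi-energy bracket: corner
# monotonicity in the four band parameters and a kernel-checkable piecewise energy rule

Venture CertifiedManyBodySolver, cell `pub/hubbard-downfold` (stage S1), seat hubbard-downfold-mod-4 (technique
B); namespace `Summit.Ventures.CertifiedManyBodySolver.Downfold.Emery`. Everything here is PROVED (elementary
real inequalities). WHAT THIS IS NOT: a statement about any material; no number lives here.

Companion of `EmeryFermiSurfaceShapeBox` (whose `fsRatio_mem_Icc` decouples the two weights `fsD`, `fsN`):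

* `fsRatio_mono_Delta`, `fsRatio_mono_tpd`, `fsRatio_anti_tpp`, `fsRatio_anti_c` — at FIXED energy the
  Fermi-surface ratio `t′/t = −fsN/(fsD + 2fsN)` is increasing in `Δ_pd` and `t_pd` (the latter by the exact
  identity `fsN(a₁)fsD(a₂) − fsN(a₂)fsD(a₁) = (Δ + ε)ε(t_pp′ + t_pp)²(a₂² − a₁²)`) and decreasing in `t_pp`,
  `t_pp′`; hence on a box it is bracketed by two opposite CORNERS (`fsRatio_corner_bounds`) — no decoupling
  loss in the parameters.
* `ratioCheck Δ a b c e_a e_b m lo hi` — a boolean check (rational arithmetic, `decide`) that at a rational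
  corner the ratio stays in `[lo, hi]` for every energy of `[e_a, e_b]`, by the corner rule of
  `EmeryFermiSurfaceShapeBox` on `m` energy pieces; soundness `fsRatio_mem_of_ratioCheck`.

Used with the Fermi-energy bracket of `EmeryFermiFillingCount` to word a 3BE box ⇒ object-E `t′/t` window.
Sources: [AndersenEtAl1995, §6]; [HybertsenSchluterChristensen1989, Eq. (1)].
-/

noncomputable section

namespace Summit.Ventures.CertifiedManyBodySolver.Downfold.Emery

open Real Set
/-! ## §5 The `t′/t` window on a Fermi-energy bracket: corner monotonicity and a piecewise check -/

/-- `fsRatio` is INCREASING in `Δ` at fixed energy (only `fsD` moves, upward), in the cuprate regime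
`fsD, fsN > 0`. [folklore] -/
theorem fsRatio_mono_Delta {Δ₁ Δ₂ tpd tpp c ε : ℝ} (h : Δ₁ ≤ Δ₂) (hT : 0 ≤ tpd ^ 2 - c * ε)
    (hd : 0 < fsD Δ₁ tpd c ε) (hn : 0 < fsN tpd tpp c ε) :
    fsRatio Δ₁ tpd tpp c ε ≤ fsRatio Δ₂ tpd tpp c ε := by
  rw [fsRatio_eq, fsRatio_eq]
  refine neg_div_add_mono_d hd ?_ hn
  unfold fsD at hd ⊢
  nlinarith

/-- `fsRatio` is DECREASING in `t_pp` at fixed energy (only `fsN` moves, upward; `t_pp, ε ≥ 0`). [folklore] -/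
theorem fsRatio_anti_tpp {Δ tpd tpp₁ tpp₂ c ε : ℝ} (h : tpp₁ ≤ tpp₂) (htpp : 0 ≤ tpp₁) (hε : 0 ≤ ε)
    (hd : 0 < fsD Δ tpd c ε) (hn : 0 < fsN tpd tpp₁ c ε) :
    fsRatio Δ tpd tpp₂ c ε ≤ fsRatio Δ tpd tpp₁ c ε := by
  rw [fsRatio_eq, fsRatio_eq]
  refine neg_div_add_anti_n hd hn ?_
  unfold fsN
  nlinarith [sq_nonneg tpd, mul_nonneg hε (mul_nonneg (add_nonneg htpp (htpp.trans h)) (sub_nonneg.2 h))]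

/-- `fsRatio` is DECREASING in `t_pp′` at fixed energy (`fsD` moves down, `fsN` up; `Δ + ε ≥ 0`, `ε ≥ 0`,
`t_pd² ≥ (t_pp′₁ + t_pp′₂)ε/… ` encoded as `0 ≤ 2t_pd² − (c₁ + c₂)ε`). [folklore] -/
theorem fsRatio_anti_c {Δ tpd tpp c₁ c₂ ε : ℝ} (h : c₁ ≤ c₂) (hΔε : 0 ≤ Δ + ε) (hε : 0 ≤ ε)
    (hcap : 0 ≤ 2 * tpd ^ 2 - (c₁ + c₂) * ε)
    (hd : 0 < fsD Δ tpd c₂ ε) (hn : 0 < fsN tpd tpp c₁ ε) :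
    fsRatio Δ tpd tpp c₂ ε ≤ fsRatio Δ tpd tpp c₁ ε := by
  rw [fsRatio_eq, fsRatio_eq]
  have hdd : fsD Δ tpd c₂ ε ≤ fsD Δ tpd c₁ ε := by
    unfold fsD; nlinarith [mul_nonneg hΔε hε]
  have hnn : fsN tpd tpp c₁ ε ≤ fsN tpd tpp c₂ ε := by
    unfold fsN
    have : fsN tpd tpp c₂ ε - fsN tpd tpp c₁ ε = (c₂ - c₁) * (2 * tpd ^ 2 - (c₁ + c₂) * ε) := by
      unfold fsN; ring
    nlinarith [mul_nonneg (sub_nonneg.2 h) hcap]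
  have hn₂ : 0 < fsN tpd tpp c₂ ε := lt_of_lt_of_le hn hnn
  calc -fsN tpd tpp c₂ ε / (fsD Δ tpd c₂ ε + 2 * fsN tpd tpp c₂ ε)
      ≤ -fsN tpd tpp c₂ ε / (fsD Δ tpd c₁ ε + 2 * fsN tpd tpp c₂ ε) := neg_div_add_mono_d hd hdd hn₂
    _ ≤ -fsN tpd tpp c₁ ε / (fsD Δ tpd c₁ ε + 2 * fsN tpd tpp c₁ ε) :=
        neg_div_add_anti_n (lt_of_lt_of_le hd hdd) hn hnn

/-- `fsRatio` is INCREASING in `t_pd` at fixed energy: `fsN(a₁)·fsD(a₂) − fsN(a₂)·fsD(a₁) =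
(Δ + ε)ε(t_pp′ + t_pp)²(a₂² − a₁²) ≥ 0`. [folklore] -/
theorem fsRatio_mono_tpd {Δ a₁ a₂ tpp c ε : ℝ} (h : a₁ ≤ a₂) (ha : 0 ≤ a₁) (hΔε : 0 ≤ Δ + ε) (hε : 0 ≤ ε)
    (hd₁ : 0 < fsD Δ a₁ c ε) (hd₂ : 0 < fsD Δ a₂ c ε) (hn₁ : 0 < fsN a₁ tpp c ε)
    (hn₂ : 0 < fsN a₂ tpp c ε) :
    fsRatio Δ a₁ tpp c ε ≤ fsRatio Δ a₂ tpp c ε := by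
  rw [fsRatio_eq, fsRatio_eq, div_le_div_iff₀ (by linarith) (by linarith)]
  have key : fsN a₁ tpp c ε * fsD Δ a₂ c ε - fsN a₂ tpp c ε * fsD Δ a₁ c ε
      = (Δ + ε) * ε * (c + tpp) ^ 2 * (a₂ ^ 2 - a₁ ^ 2) := by
    unfold fsN fsD; ring
  have hsq : a₁ ^ 2 ≤ a₂ ^ 2 := pow_le_pow_left₀ ha h 2
  have hpos : 0 ≤ (Δ + ε) * ε * (c + tpp) ^ 2 * (a₂ ^ 2 - a₁ ^ 2) :=
    mul_nonneg (mul_nonneg (mul_nonneg hΔε hε) (sq_nonneg _)) (sub_nonneg.2 hsq)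
  nlinarith

/-- **CORNER BOUNDS**: on a parameter box `Δ ∈ [Δ₁, Δ₂]`, `t_pd ∈ [a₁, a₂]`, `t_pp ∈ [b₁, b₂]`,
`t_pp′ ∈ [c₁, c₂]` (cuprate regime: `0 < a₁`, `0 ≤ c₁`, `c₂ < b₁`, `0 ≤ ε`, `0 < Δ₁ + ε`, `2c₂ε ≤ a₁²`) the
Fermi-surface `t′/t` at energy `ε` is bracketed by its values at the two opposite corners
`(Δ₁, a₁, b₂, c₂)` and `(Δ₂, a₂, b₁, c₁)`. [folklore] -/
theorem fsRatio_corner_bounds {Δ₁ Δ₂ a₁ a₂ b₁ b₂ c₁ c₂ Δ tpd tpp c ε : ℝ}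
    (ha₁ : 0 < a₁) (hc₁ : 0 ≤ c₁) (hcb : c₂ < b₁) (hε : 0 ≤ ε) (hΔε : 0 < Δ₁ + ε)
    (hcap : 2 * c₂ * ε ≤ a₁ ^ 2)
    (hΔ : Δ ∈ Set.Icc Δ₁ Δ₂) (ha : tpd ∈ Set.Icc a₁ a₂) (hb : tpp ∈ Set.Icc b₁ b₂)
    (hc : c ∈ Set.Icc c₁ c₂) :
    fsRatio Δ₁ a₁ b₂ c₂ ε ≤ fsRatio Δ tpd tpp c ε ∧ fsRatio Δ tpd tpp c ε ≤ fsRatio Δ₂ a₂ b₁ c₁ ε := by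
  obtain ⟨hΔlo, hΔhi⟩ := hΔ
  obtain ⟨halo, hahi⟩ := ha
  obtain ⟨hblo, hbhi⟩ := hb
  obtain ⟨hclo, hchi⟩ := hc
  have hc0 : 0 ≤ c := hc₁.trans hclo
  have hc₂0 : 0 ≤ c₂ := hc0.trans hchi
  have htpd : 0 < tpd := lt_of_lt_of_le ha₁ halo
  have ha₂ : 0 < a₂ := lt_of_lt_of_le htpd hahi
  -- positivity of the two weights everywhere on the box
  have hsq₁ : a₁ ^ 2 ≤ tpd ^ 2 := pow_le_pow_left₀ ha₁.le halo 2
  have hsq₂ : tpd ^ 2 ≤ a₂ ^ 2 := pow_le_pow_left₀ htpd.le hahi 2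
  have dpos : ∀ {Δ' T' c' : ℝ}, Δ₁ ≤ Δ' → a₁ ≤ T' → 0 ≤ c' → c' ≤ c₂ → 0 < fsD Δ' T' c' ε := by
    intro Δ' T' c' h1 h2 h3 h4
    unfold fsD
    have hT : a₁ ^ 2 ≤ T' ^ 2 := pow_le_pow_left₀ ha₁.le h2 2
    have : 0 < T' ^ 2 - c' * ε := by nlinarith [mul_le_mul_of_nonneg_right h4 hε]
    exact mul_pos (by linarith) this
  have npos : ∀ {T' b' c' : ℝ}, a₁ ≤ T' → b₁ ≤ b' → 0 ≤ c' → c' ≤ c₂ → 0 < fsN T' b' c' ε := by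
    intro T' b' c' h1 h2 h3 h4
    rw [fsN_eq_mul]
    have hT : a₁ ^ 2 ≤ T' ^ 2 := pow_le_pow_left₀ ha₁.le h1 2
    have hbc : 0 ≤ b' - c' := by linarith
    exact mul_pos (by linarith) (by nlinarith [mul_nonneg hε hbc])
  constructor
  · calc fsRatio Δ₁ a₁ b₂ c₂ ε ≤ fsRatio Δ₁ a₁ tpp c₂ ε :=
          fsRatio_anti_tpp hbhi (hblo.trans' (hcb.le.trans' hc₂0) |> fun _ => by linarith) hε
            (dpos le_rfl le_rfl hc₂0 le_rfl) (npos le_rfl hblo hc₂0 le_rfl)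
      _ ≤ fsRatio Δ₁ a₁ tpp c ε :=
          fsRatio_anti_c hchi hΔε.le hε (by nlinarith) (dpos le_rfl le_rfl hc₂0 le_rfl)
            (npos le_rfl hblo hc0 hchi)
      _ ≤ fsRatio Δ₁ tpd tpp c ε :=
          fsRatio_mono_tpd halo ha₁.le hΔε.le hε (dpos le_rfl le_rfl hc0 hchi) (dpos le_rfl halo hc0 hchi)
            (npos le_rfl hblo hc0 hchi) (npos halo hblo hc0 hchi)
      _ ≤ fsRatio Δ tpd tpp c ε :=
          fsRatio_mono_Delta hΔlo (by nlinarith [mul_le_mul_of_nonneg_right hchi hε])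
            (dpos le_rfl halo hc0 hchi) (npos halo hblo hc0 hchi)
  · calc fsRatio Δ tpd tpp c ε ≤ fsRatio Δ₂ tpd tpp c ε :=
          fsRatio_mono_Delta hΔhi (by nlinarith [mul_le_mul_of_nonneg_right hchi hε])
            (dpos hΔlo halo hc0 hchi) (npos halo hblo hc0 hchi)
      _ ≤ fsRatio Δ₂ a₂ tpp c ε :=
          fsRatio_mono_tpd hahi htpd.le (by linarith) hε (dpos (hΔlo.trans hΔhi) halo hc0 hchi)
            (dpos (hΔlo.trans hΔhi) (halo.trans hahi) hc0 hchi) (npos halo hblo hc0 hchi)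
            (npos (halo.trans hahi) hblo hc0 hchi)
      _ ≤ fsRatio Δ₂ a₂ tpp c₁ ε :=
          fsRatio_anti_c hclo (by linarith) hε (by nlinarith)
            (dpos (hΔlo.trans hΔhi) (halo.trans hahi) hc0 hchi)
            (npos (halo.trans hahi) hblo hc₁ (hclo.trans hchi))
      _ ≤ fsRatio Δ₂ a₂ b₁ c₁ ε :=
          fsRatio_anti_tpp hblo (by linarith) hε (dpos (hΔlo.trans hΔhi) (halo.trans hahi) hc₁ (hclo.trans hchi))
            (npos (halo.trans hahi) le_rfl hc₁ (hclo.trans hchi))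

/-- Every real `s ∈ [0, m]` lies in some unit interval `[j, j + 1]`, `j < m`. [folklore] -/
theorem exists_floorIndex {m : ℕ} (hm : 0 < m) {s : ℝ} (h0 : 0 ≤ s) (hs : s ≤ m) :
    ∃ j, j < m ∧ (j : ℝ) ≤ s ∧ s ≤ j + 1 := by
  rcases lt_or_ge s m with hlt | hge
  · refine ⟨⌊s⌋₊, (Nat.floor_lt h0).2 hlt, Nat.floor_le h0, (Nat.lt_floor_add_one s).le⟩
  · refine ⟨m - 1, Nat.sub_lt hm Nat.one_pos, ?_, ?_⟩
    · rw [Nat.cast_sub hm]; push_cast; linarith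
    · rw [Nat.cast_sub hm]; push_cast; linarith [le_antisymm hs hge]

/-- Piece endpoint `e_j = e_a + (e_b − e_a)·j/m` of the uniform subdivision of `[e_a, e_b]`. [folklore] -/
def piecePt (ea eb : ℚ) (m j : ℕ) : ℚ := ea + (eb - ea) * j / m

/-- Certified lower value of `fsRatio` on piece `j` (corner rule `fsRatio_mem_Icc` with `fsD_mem_Icc`,
`fsN_mem_Icc` on the energy interval `[e_j, e_{j+1}]`). [folklore] -/
def ratioLoVal (Δq aq bq cq ea eb : ℚ) (m j : ℕ) : ℚ :=
  let e1 := piecePt ea eb m j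
  let e2 := piecePt ea eb m (j + 1)
  let dlo := (Δq + e1) * (aq ^ 2 - cq * e2)
  let nhi := (cq + bq) * (2 * aq ^ 2 + max (e1 * (bq - cq)) (e2 * (bq - cq)))
  (-nhi) / (dlo + 2 * nhi)

/-- Certified upper value of `fsRatio` on piece `j`. [folklore] -/
def ratioHiVal (Δq aq bq cq ea eb : ℚ) (m j : ℕ) : ℚ :=
  let e1 := piecePt ea eb m j
  let e2 := piecePt ea eb m (j + 1)
  let dhi := (Δq + e2) * (aq ^ 2 - cq * e1)
  let nlo := (cq + bq) * (2 * aq ^ 2 + min (e1 * (bq - cq)) (e2 * (bq - cq)))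
  (-nlo) / (dhi + 2 * nlo)

/-- Boolean check that `fsRatio(Δq, aq, bq, cq, ε) ∈ [lo, hi]` for every `ε ∈ [e_a, e_b]`, by the corner rule
on `m` energy pieces. [folklore] -/
def ratioCheck (Δq aq bq cq ea eb : ℚ) (m : ℕ) (lo hi : ℚ) : Bool :=
  decide (0 < m) && decide (ea ≤ eb) && decide (0 ≤ ea) && decide (0 ≤ aq) && decide (0 ≤ bq) &&
  decide (0 ≤ cq) && decide (0 ≤ Δq + ea) && decide (cq * eb ≤ aq ^ 2) &&
  (List.range m).all fun j =>
    decide (0 < (Δq + piecePt ea eb m j) * (aq ^ 2 - cq * piecePt ea eb m (j + 1))) &&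
    decide (0 < (cq + bq) * (2 * aq ^ 2 +
      min (piecePt ea eb m j * (bq - cq)) (piecePt ea eb m (j + 1) * (bq - cq)))) &&
    decide (lo ≤ ratioLoVal Δq aq bq cq ea eb m j) && decide (ratioHiVal Δq aq bq cq ea eb m j ≤ hi)

/-- `e_a ≤ e_j` (for `e_a ≤ e_b`). [folklore] -/
theorem left_le_piecePt {ea eb : ℚ} (m j : ℕ) (hab : ea ≤ eb) : ea ≤ piecePt ea eb m j := by
  unfold piecePt
  have : 0 ≤ (eb - ea) * j / m := div_nonneg (mul_nonneg (sub_nonneg.2 hab) (Nat.cast_nonneg _)) (Nat.cast_nonneg _)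
  linarith

/-- `e_j ≤ e_b` for `j ≤ m` (`0 < m`, `e_a ≤ e_b`). [folklore] -/
theorem piecePt_le_right {ea eb : ℚ} {m j : ℕ} (hm : 0 < m) (hab : ea ≤ eb) (hj : j ≤ m) :
    piecePt ea eb m j ≤ eb := by
  unfold piecePt
  have hmq : (0 : ℚ) < m := by exact_mod_cast hm
  have hjm : (j : ℚ) ≤ m := by exact_mod_cast hj
  have key : (eb - ea) * j / m ≤ eb - ea := by
    rw [div_le_iff₀ hmq]
    exact mul_le_mul_of_nonneg_left hjm (sub_nonneg.2 hab)
  linarith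

/-- Every energy of `[e_a, e_b]` lies in some piece `[e_j, e_{j+1}]`, `j < m`. [folklore] -/
theorem exists_pieceIndex {ea eb : ℚ} {m : ℕ} (hm : 0 < m) (hab : ea ≤ eb) {ε : ℝ}
    (hε : ε ∈ Set.Icc (ea : ℝ) eb) :
    ∃ j, j < m ∧ (piecePt ea eb m j : ℝ) ≤ ε ∧ ε ≤ (piecePt ea eb m (j + 1) : ℝ) := by
  obtain ⟨hεlo, hεhi⟩ := hε
  have hmr : (0 : ℝ) < m := by exact_mod_cast hm
  rcases eq_or_lt_of_le hab with heq | hlt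
  · refine ⟨0, hm, ?_, ?_⟩
    · simp only [piecePt, Nat.cast_zero, mul_zero, zero_div, add_zero]; exact hεlo
    · have h1 : (eb : ℝ) = ea := by exact_mod_cast heq.symm
      have h2 : (piecePt ea eb m (0 + 1) : ℝ) = ea := by
        simp only [piecePt, ← heq, sub_self, zero_mul, zero_div, add_zero]
      rw [h2]; linarith
  · have hw : (0 : ℝ) < eb - ea := by
      have : (ea : ℝ) < eb := by exact_mod_cast hlt
      linarith
    set s : ℝ := (ε - ea) / (eb - ea) * m with hs
    have hs0 : 0 ≤ s := by rw [hs]; exact mul_nonneg (div_nonneg (by linarith) hw.le) hmr.le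
    have hsm : s ≤ m := by
      rw [hs]
      have : (ε - ea) / (eb - ea) ≤ 1 := by rw [div_le_one hw]; linarith
      nlinarith
    obtain ⟨j, hj, hjs, hsj⟩ := exists_floorIndex hm hs0 hsm
    have hεs : ε = ea + (eb - ea) * s / m := by rw [hs]; field_simp; ring
    have cast_pt : ∀ i : ℕ, (piecePt ea eb m i : ℝ) = ea + (eb - ea) * (i : ℝ) / m := by
      intro i; simp only [piecePt]; push_cast; ring
    refine ⟨j, hj, ?_, ?_⟩
    · rw [cast_pt, hεs]
      have := div_le_div_of_nonneg_right (mul_le_mul_of_nonneg_left hjs hw.le) hmr.le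
      linarith
    · rw [cast_pt, hεs]
      have := div_le_div_of_nonneg_right (mul_le_mul_of_nonneg_left hsj hw.le) hmr.le
      push_cast
      linarith

/-- **Soundness of `ratioCheck`**: the Fermi-surface `t′/t` at the rational parameter point lies in
`[lo, hi]` for every energy of the bracket. [folklore] -/
theorem fsRatio_mem_of_ratioCheck {Δq aq bq cq ea eb lo hi : ℚ} {m : ℕ}
    (h : ratioCheck Δq aq bq cq ea eb m lo hi = true) {ε : ℝ} (hε : ε ∈ Set.Icc (ea : ℝ) eb) :
    fsRatio Δq aq bq cq ε ∈ Set.Icc (lo : ℝ) hi := by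
  simp only [ratioCheck, Bool.and_eq_true, decide_eq_true_eq, List.all_eq_true, List.mem_range] at h
  obtain ⟨⟨⟨⟨⟨⟨⟨⟨hm, hab⟩, hea⟩, haq⟩, hbq⟩, hcq⟩, hΔe⟩, hcap⟩, hall⟩ := h
  obtain ⟨j, hj, hj1, hj2⟩ := exists_pieceIndex hm hab hε
  obtain ⟨⟨⟨hd, hn⟩, hlo⟩, hhi⟩ := hall j hj
  -- rational side conditions on the piece
  have q1 : 0 ≤ piecePt ea eb m j := hea.trans (left_le_piecePt m j hab)
  have q2 : 0 ≤ Δq + piecePt ea eb m j := hΔe.trans (by linarith [left_le_piecePt (ea := ea) (eb := eb) m j hab])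
  have q3 : cq * piecePt ea eb m (j + 1) ≤ aq ^ 2 :=
    (mul_le_mul_of_nonneg_left (piecePt_le_right hm hab hj) hcq).trans hcap
  -- the corner rule on the piece (degenerate parameter box)
  have hD := fsD_mem_Icc (Δ₁ := (Δq : ℝ)) (Δ₂ := Δq) (a₁ := aq) (a₂ := aq) (c₁ := cq) (c₂ := cq)
    (ε₁ := (piecePt ea eb m j : ℝ)) (ε₂ := (piecePt ea eb m (j + 1) : ℝ)) (Δ := Δq) (tpd := aq) (c := cq)
    (ε := ε) (by exact_mod_cast haq) (by exact_mod_cast hcq) (by exact_mod_cast q1) (by exact_mod_cast q2)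
    (by exact_mod_cast q3) ⟨le_rfl, le_rfl⟩ ⟨le_rfl, le_rfl⟩ ⟨le_rfl, le_rfl⟩ ⟨hj1, hj2⟩
  have hN := fsN_mem_Icc (a₁ := (aq : ℝ)) (a₂ := aq) (b₁ := bq) (b₂ := bq) (c₁ := cq) (c₂ := cq)
    (ε₁ := (piecePt ea eb m j : ℝ)) (ε₂ := (piecePt ea eb m (j + 1) : ℝ)) (tpd := aq) (tpp := bq) (c := cq)
    (ε := ε) (by exact_mod_cast haq) (by exact_mod_cast hbq) (by exact_mod_cast hcq) (by exact_mod_cast q1)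
    (by exact_mod_cast q3) ⟨le_rfl, le_rfl⟩ ⟨le_rfl, le_rfl⟩ ⟨le_rfl, le_rfl⟩ ⟨hj1, hj2⟩
  have hd' : (0 : ℝ) < ((Δq : ℝ) + piecePt ea eb m j) * ((aq : ℝ) ^ 2 - cq * piecePt ea eb m (j + 1)) := by
    exact_mod_cast hd
  have hn' : (0 : ℝ) < ((cq : ℝ) + bq) * (2 * (aq : ℝ) ^ 2 +
      min ((piecePt ea eb m j : ℝ) * (bq - cq)) ((piecePt ea eb m (j + 1) : ℝ) * (bq - cq))) := by
    exact_mod_cast hn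
  have hR := fsRatio_mem_Icc hd' hn' hD hN
  have hlo' : ((lo : ℚ) : ℝ) ≤ (ratioLoVal Δq aq bq cq ea eb m j : ℝ) := by exact_mod_cast hlo
  have hhi' : (ratioHiVal Δq aq bq cq ea eb m j : ℝ) ≤ ((hi : ℚ) : ℝ) := by exact_mod_cast hhi
  simp only [ratioLoVal, ratioHiVal] at hlo' hhi'
  push_cast at hlo' hhi' hR
  exact ⟨hlo'.trans hR.1, hR.2.trans hhi'⟩

end Summit.Ventures.CertifiedManyBodySolver.Downfold.Emery
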